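import Mathlib
import Summits.ValiantsHypothesis.ValiantsHypothesis.Theses.ValuativeGCT
import Summits.ValiantsHypothesis.ValiantsHypothesis.Theorems.ValuativeGCTNoValuativeFlipOutsideKL
import Summits.ValiantsHypothesis.ValiantsHypothesis.Theorems.ValuativeGCTNoValuativeFlipBeyondGrenet
import Summits.ValiantsHypothesis.ValiantsHypothesis.Theorems.ValuativeGCTNoValuativeFlipBoundedLength

/-!
# `NoValuativeFlip` (stmt-ValiantsHypothesis-12629): the residual statement

Route `ValuativeGCT`, support item `NoValuativeFlip`. Given the route's `ValuativeBound`, the kill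
statement `NoValuativeFlip` is EQUIVALENT to its restriction to the residual range not covered by
the unconditional theorems of this session:

* `m + 1 < 2ⁿ` (below Grenet's bound; above it there is no obstruction at all,
  `ValuativeGCTNoValuativeFlipBeyondGrenet`),
* `λ` a Kadish–Landsberg shape, `δ (m - n) ≤ λ₁` and `ℓ(λ) ≤ n² + 1` (elsewhere `mult_pp = 0`,
  `ValuativeGCTNoValuativeFlipOutsideKL`),
* `m < 1 + n (n + 1)^{ℓ(λ)}`, i.e. `ℓ(λ)` beyond the inheritance range (for
  `m ≥ 1 + n (n + 1)^{ℓ(λ)}` there is no multiplicity obstruction at `λ`,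
  `ValuativeGCTNoValuativeFlipBoundedLength`).

`noValuativeFlip_iff_residual` records this: what remains of the item is a per-side multiplicity
bound on Kadish–Landsberg shapes whose length grows with `n`, at paddings `n ^ c₀ ≤ m < 2ⁿ - 1` —
the open multiplicity no-go question (Bläser–Ikenmeyer 2025 §12.4), cf. `GCTMult.GctNoMultBarrier`.
-/

-- `Summit.ValiantsHypothesis.ValiantsHypothesis.…` repeats a component by the D-0017 layout
-- (single-conjunct summit), which the `dupNamespace` linter flags; the name is mandated.
set_option linter.dupNamespace false

namespace Summit.ValiantsHypothesis.ValiantsHypothesis.Theorems.NoValuativeFlip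

open Literature.NumberTheory.DiophantineGeometry Literature.Computability.AlgebraicComplexity
open Summit.ValiantsHypothesis.ValiantsHypothesis.Theses.ValuativeGCT

/-- **The residual form of `NoValuativeFlip`.** Given `ValuativeBound`, `NoValuativeFlip` holds iff
it holds on the residual range: paddings `n ^ c₀ ≤ m` with `m + 1 < 2ⁿ`, Kadish–Landsberg shapes
(`δ (m - n) ≤ λ₁`, `ℓ(λ) ≤ n² + 1`) of length beyond the inheritance range
(`m < 1 + n (n + 1)^{ℓ(λ)}`). The three excluded ranges are theorems:
`noValuativeFlip_body_of_two_pow_le`, `noValuativeFlip_body_of_not_kadishLandsberg`,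
`noValuativeFlip_body_of_card_parts`. -/
theorem noValuativeFlip_iff_residual (hVB : ValuativeBound) :
    NoValuativeFlip ↔
    ∃ c₀ n₀ : ℕ, ∀ n ≥ n₀, ∀ (m : ℕ) [NeZero m], n ^ c₀ ≤ m → m + 1 < 2 ^ n → ∀ (U : Submodule ℂ (Literature.NumberTheory.DiophantineGeometry.MatIdx m → ℂ)) (r : ℕ), (∀ u ∈ U, (Matrix.of fun a b : Fin m => u (toLex (a, b))).rank ≤ r) → ∀ (δ : ℕ) (lam : Nat.Partition (m * δ)), lam.parts.card ≤ m * m → δ * (m - n) ≤ lam.parts.sup → lam.parts.card ≤ n ^ 2 + 1 → m < 1 + n * (n + 1) ^ lam.parts.card → let χ : Literature.NumberTheory.DiophantineGeometry.Weight (Literature.NumberTheory.DiophantineGeometry.MatIdx m) := (Literature.NumberTheory.DiophantineGeometry.Weight.dualOfPartition (m * m) lam).toMatIdx; let T : Submodule ℂ (MvPolynomial (Literature.NumberTheory.DiophantineGeometry.MatIdx m × Literature.NumberTheory.DiophantineGeometry.MatIdx m) ℂ) := MvPolynomial.homogeneousSubmodule (Literature.NumberTheory.DiophantineGeometry.MatIdx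 m × Literature.NumberTheory.DiophantineGeometry.MatIdx m) ℂ (m * δ) ⊓ ((MvPolynomial.vanishingIdeal ℂ {p : Literature.NumberTheory.DiophantineGeometry.MatIdx m × Literature.NumberTheory.DiophantineGeometry.MatIdx m → ℂ | ∀ j : Literature.NumberTheory.DiophantineGeometry.MatIdx m, (fun i => p (j, i)) ∈ U}) ^ (δ * (m - r))).restrictScalars ℂ ⊓ (⨅ (M : Matrix (Literature.NumberTheory.DiophantineGeometry.MatIdx m) (Literature.NumberTheory.DiophantineGeometry.MatIdx m) ℂ) (_ : Literature.Computability.AlgebraicComplexity.linSubst (Literature.NumberTheory.DiophantineGeometry.MatIdx m) ℂ M (Literature.NumberTheory.DiophantineGeometry.detFormLex ℂ m) = Literature.NumberTheory.DiophantineGeometry.detFormLex ℂ m), LinearMap.ker ((MvPolynomial.aeval (R := ℂ) fun p : Literature.NumberTheory.DiophantineGeometry.MatIdx m × Literature.NumberTheory.DiophantineGeometry.MatIdx m => ∑ l : Literature.NumberTheory.DiophantineGeometry.MatIdx m, M l p.2 • MvPolynomial.X (p.1, l)).toLinearMap - LinearMap.id (R := ℂ) (M := MvPolynomial (Literature.NumberTheory.DiophantineGeometry.MatIdx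 m × Literature.NumberTheory.DiophantineGeometry.MatIdx m) ℂ))) ⊓ (⨅ (g : Matrix.GeneralLinearGroup (Literature.NumberTheory.DiophantineGeometry.MatIdx m) ℂ) (_ : Literature.NumberTheory.DiophantineGeometry.IsUpperTriangular g), LinearMap.ker ((MvPolynomial.aeval (R := ℂ) fun p : Literature.NumberTheory.DiophantineGeometry.MatIdx m × Literature.NumberTheory.DiophantineGeometry.MatIdx m => ∑ l : Literature.NumberTheory.DiophantineGeometry.MatIdx m, ((g⁻¹ : Matrix.GeneralLinearGroup (Literature.NumberTheory.DiophantineGeometry.MatIdx m) ℂ) : Matrix (Literature.NumberTheory.DiophantineGeometry.MatIdx m) (Literature.NumberTheory.DiophantineGeometry.MatIdx m) ℂ) p.1 l • MvPolynomial.X (l, p.2)).toLinearMap - Literature.NumberTheory.DiophantineGeometry.weightChar χ g • LinearMap.id (R := ℂ) (M := MvPolynomial (Literature.NumberTheory.DiophantineGeometry.MatIdx m × Literature.NumberTheory.DiophantineGeometry.MatIdx m) ℂ))); Literature.NumberTheory.DiophantineGeometry.orbitMultiplicity ℂ (Literature.NumberTheory.DiophantineGeometry.paddedPerFormLex ℂ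 n m) m χ ≤ Module.finrank ℂ ↥T := by
  constructor
  · rintro ⟨c₀, n₀, h⟩
    exact ⟨c₀, n₀, fun n hn m _ hm _ U r hU δ lam hcard _ _ _ => h n hn m hm U r hU δ lam hcard⟩
  · rintro ⟨c₀, n₀, h⟩
    refine ⟨c₀ + 1, max n₀ 1, fun n hn m _ hm U r hU δ lam hcard => ?_⟩
    have hn0 : n₀ ≤ n := (le_max_left _ _).trans hn
    have hn1 : 1 ≤ n := (le_max_right _ _).trans hn
    have hnm : n ≤ m := (le_self_pow₀ hn1 (Nat.succ_ne_zero c₀)).trans hm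
    have hmc : n ^ c₀ ≤ m := (Nat.pow_le_pow_right hn1 (Nat.le_succ c₀)).trans hm
    by_cases hG : 2 ^ n ≤ m + 1
    · exact noValuativeFlip_body_of_two_pow_le hVB m hG U r hU δ lam hcard
    by_cases hKL : lam.parts.sup < δ * (m - n) ∨ n ^ 2 + 1 < lam.parts.card
    · exact noValuativeFlip_body_of_not_kadishLandsberg m hnm U r δ lam hcard hKL
    by_cases hI : 1 + n * (n + 1) ^ lam.parts.card ≤ m
    · exact noValuativeFlip_body_of_card_parts hVB m U r hU δ lam hcard hI
    · rw [not_or, not_lt, not_lt] at hKL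
      exact h n hn0 m hmc (by omega) U r hU δ lam hcard hKL.1 hKL.2 (by omega)

/-- **Constraints on valuative-flip witnesses** (contrapositive packaging of the three landed
no-flip ranges, for the crux `ValuativeFlip`, stmt-ValiantsHypothesis-12624). Given
`ValuativeBound`, if at `(n, m)` with `n ≤ m` some centre `(U, r)` (ranks `≤ r` on `U`), degree
`δ` and shape `λ ⊢ m δ` (at most `m²` parts) satisfy the flip inequality
`dim T_U(λ) < mult_{λ*} ℂ[Δ(X₀₀^(m-n) per_n)]`, then: `m + 1 < 2ⁿ` (below Grenet), `λ` is a
Kadish–Landsberg shape (`δ (m - n) ≤ λ₁`, `ℓ(λ) ≤ n² + 1`), and `m < 1 + n (n + 1)^{ℓ(λ)}` — at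
padding `m ≥ n ^ c` with `n > 2 ^ (c - 2)` the shape has more than `c - 2` rows
(`one_add_mul_succ_pow_le_pow`). -/
theorem valuativeFlip_witness_constraints (hVB : ValuativeBound) {n : ℕ} (m : ℕ) [NeZero m]
    (hnm : n ≤ m) (U : Submodule ℂ (MatIdx m → ℂ)) (r : ℕ)
    (hU : ∀ u ∈ U, (Matrix.of fun a b : Fin m => u (toLex (a, b))).rank ≤ r)
    (δ : ℕ) (lam : Nat.Partition (m * δ)) (hcard : lam.parts.card ≤ m * m)
    (hflip : let χ : Literature.NumberTheory.DiophantineGeometry.Weight (Literature.NumberTheory.DiophantineGeometry.MatIdx m) := (Literature.NumberTheory.DiophantineGeometry.Weight.dualOfPartition (m * m) lam).toMatIdx; let T : Submodule ℂ (MvPolynomial (Literature.NumberTheory.DiophantineGeometry.MatIdx m × Literature.NumberTheory.DiophantineGeometry.MatIdx m) ℂ) := MvPolynomial.homogeneousSubmodule (Literature.NumberTheory.DiophantineGeometry.MatIdx m × Literature.NumberTheory.DiophantineGeometry.MatIdx m) ℂ (m * δ) ⊓ ((MvPolynomial.vanishingIdeal ℂ {p : Literature.NumberTheory.DiophantineGeometry.MatIdx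 m × Literature.NumberTheory.DiophantineGeometry.MatIdx m → ℂ | ∀ j : Literature.NumberTheory.DiophantineGeometry.MatIdx m, (fun i => p (j, i)) ∈ U}) ^ (δ * (m - r))).restrictScalars ℂ ⊓ (⨅ (M : Matrix (Literature.NumberTheory.DiophantineGeometry.MatIdx m) (Literature.NumberTheory.DiophantineGeometry.MatIdx m) ℂ) (_ : Literature.Computability.AlgebraicComplexity.linSubst (Literature.NumberTheory.DiophantineGeometry.MatIdx m) ℂ M (Literature.NumberTheory.DiophantineGeometry.detFormLex ℂ m) = Literature.NumberTheory.DiophantineGeometry.detFormLex ℂ m), LinearMap.ker ((MvPolynomial.aeval (R := ℂ) fun p : Literature.NumberTheory.DiophantineGeometry.MatIdx m × Literature.NumberTheory.DiophantineGeometry.MatIdx m => ∑ l : Literature.NumberTheory.DiophantineGeometry.MatIdx m, M l p.2 • MvPolynomial.X (p.1, l)).toLinearMap - LinearMap.id (R := ℂ) (M := MvPolynomial (Literature.NumberTheory.DiophantineGeometry.MatIdx m × Literature.NumberTheory.DiophantineGeometry.MatIdx m) ℂ))) ⊓ (⨅ (g : Matrix.GeneralLinearGroup (Literature.NumberTheory.DiophantineGeometry.MatIdx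 m) ℂ) (_ : Literature.NumberTheory.DiophantineGeometry.IsUpperTriangular g), LinearMap.ker ((MvPolynomial.aeval (R := ℂ) fun p : Literature.NumberTheory.DiophantineGeometry.MatIdx m × Literature.NumberTheory.DiophantineGeometry.MatIdx m => ∑ l : Literature.NumberTheory.DiophantineGeometry.MatIdx m, ((g⁻¹ : Matrix.GeneralLinearGroup (Literature.NumberTheory.DiophantineGeometry.MatIdx m) ℂ) : Matrix (Literature.NumberTheory.DiophantineGeometry.MatIdx m) (Literature.NumberTheory.DiophantineGeometry.MatIdx m) ℂ) p.1 l • MvPolynomial.X (l, p.2)).toLinearMap - Literature.NumberTheory.DiophantineGeometry.weightChar χ g • LinearMap.id (R := ℂ) (M := MvPolynomial (Literature.NumberTheory.DiophantineGeometry.MatIdx m × Literature.NumberTheory.DiophantineGeometry.MatIdx m) ℂ))); Module.finrank ℂ ↥T < Literature.NumberTheory.DiophantineGeometry.orbitMultiplicity ℂ (Literature.NumberTheory.DiophantineGeometry.paddedPerFormLex ℂ n m) m χ) :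
    m + 1 < 2 ^ n ∧ δ * (m - n) ≤ lam.parts.sup ∧ lam.parts.card ≤ n ^ 2 + 1 ∧
      m < 1 + n * (n + 1) ^ lam.parts.card := by
  have hlt : ¬ (let χ : Literature.NumberTheory.DiophantineGeometry.Weight (Literature.NumberTheory.DiophantineGeometry.MatIdx m) := (Literature.NumberTheory.DiophantineGeometry.Weight.dualOfPartition (m * m) lam).toMatIdx; let T : Submodule ℂ (MvPolynomial (Literature.NumberTheory.DiophantineGeometry.MatIdx m × Literature.NumberTheory.DiophantineGeometry.MatIdx m) ℂ) := MvPolynomial.homogeneousSubmodule (Literature.NumberTheory.DiophantineGeometry.MatIdx m × Literature.NumberTheory.DiophantineGeometry.MatIdx m) ℂ (m * δ) ⊓ ((MvPolynomial.vanishingIdeal ℂ {p : Literature.NumberTheory.DiophantineGeometry.MatIdx m × Literature.NumberTheory.DiophantineGeometry.MatIdx m → ℂ | ∀ j : Literature.NumberTheory.DiophantineGeometry.MatIdx m, (fun i => p (j, i)) ∈ U}) ^ (δ * (m - r))).restrictScalars ℂ ⊓ (⨅ (M : Matrix (Literature.NumberTheory.DiophantineGeometry.MatIdx m) (Literature.NumberTheory.DiophantineGeometry.MatIdx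 m) ℂ) (_ : Literature.Computability.AlgebraicComplexity.linSubst (Literature.NumberTheory.DiophantineGeometry.MatIdx m) ℂ M (Literature.NumberTheory.DiophantineGeometry.detFormLex ℂ m) = Literature.NumberTheory.DiophantineGeometry.detFormLex ℂ m), LinearMap.ker ((MvPolynomial.aeval (R := ℂ) fun p : Literature.NumberTheory.DiophantineGeometry.MatIdx m × Literature.NumberTheory.DiophantineGeometry.MatIdx m => ∑ l : Literature.NumberTheory.DiophantineGeometry.MatIdx m, M l p.2 • MvPolynomial.X (p.1, l)).toLinearMap - LinearMap.id (R := ℂ) (M := MvPolynomial (Literature.NumberTheory.DiophantineGeometry.MatIdx m × Literature.NumberTheory.DiophantineGeometry.MatIdx m) ℂ))) ⊓ (⨅ (g : Matrix.GeneralLinearGroup (Literature.NumberTheory.DiophantineGeometry.MatIdx m) ℂ) (_ : Literature.NumberTheory.DiophantineGeometry.IsUpperTriangular g), LinearMap.ker ((MvPolynomial.aeval (R := ℂ) fun p : Literature.NumberTheory.DiophantineGeometry.MatIdx m × Literature.NumberTheory.DiophantineGeometry.MatIdx m => ∑ l : Literature.NumberTheory.DiophantineGeometry.MatIdx m, ((g⁻¹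 : Matrix.GeneralLinearGroup (Literature.NumberTheory.DiophantineGeometry.MatIdx m) ℂ) : Matrix (Literature.NumberTheory.DiophantineGeometry.MatIdx m) (Literature.NumberTheory.DiophantineGeometry.MatIdx m) ℂ) p.1 l • MvPolynomial.X (l, p.2)).toLinearMap - Literature.NumberTheory.DiophantineGeometry.weightChar χ g • LinearMap.id (R := ℂ) (M := MvPolynomial (Literature.NumberTheory.DiophantineGeometry.MatIdx m × Literature.NumberTheory.DiophantineGeometry.MatIdx m) ℂ))); Literature.NumberTheory.DiophantineGeometry.orbitMultiplicity ℂ (Literature.NumberTheory.DiophantineGeometry.paddedPerFormLex ℂ n m) m χ ≤ Module.finrank ℂ ↥T) := by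
    intro hle
    exact (not_le.mpr hflip) hle
  refine ⟨?_, ?_, ?_, ?_⟩
  · by_contra h
    exact hlt (noValuativeFlip_body_of_two_pow_le hVB m (by omega) U r hU δ lam hcard)
  · by_contra h
    exact hlt (noValuativeFlip_body_of_not_kadishLandsberg m hnm U r δ lam hcard (Or.inl (by omega)))
  · by_contra h
    exact hlt (noValuativeFlip_body_of_not_kadishLandsberg m hnm U r δ lam hcard (Or.inr (by omega)))
  · by_contra h
    exact hlt (noValuativeFlip_body_of_card_parts hVB m U r hU δ lam hcard (by omega))

end Summit.ValiantsHypothesis.ValiantsHypothesis.Theorems.NoValuativeFlip
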